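import Summits.RiemannHypothesis.RiemannHypothesis.Theorems.TiltedLandingLaw421R3RateBooksQ1b

/-! # TiltedLandingLaw421R3RateBooksQ2 — W-08 RATE^B BOOKS: §B.5–§B.6

Continuation of `…R3RateBooksQ1b.lean` (C4 g28 rateBooksQ-v5 sha c107456c, split per gate lint ≤ 400 l).
§B.5 refinements (class unions, COUNT form, POTENTIAL instances); §B.6 rise allowances.
RH NOT proved; 24774 OPEN. -/

namespace RhW08.SealSwapQ

open Complex
open RhIdea6.G17.W07C7 RhIdea6.G17.W07C7.Rev6 RhIdea6.G18.W07C8.Law421BirthS RhIdea6.G19.W07C11.Seam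
open RhIdea6.G20.W07C12.Frac RhIdea6.G20.W07C12.StColP RhW07.C12.FieldSplit RhIdea6.G21.W07C13.TentMax
open RhW07.C14.TwoSided RhW07.C14.Classes RhW07.C14.Lineage RhW07.C14.Booking
open RhW07.C13.Heredity RhIdea6.G22.W07C15pre.Injection RhW07.E3.Cell
open RhW07.E3.Lit
open RhW08.Round1 RhW08.StSwap RhW08.Round2 RhW08.QuadW
open RhW08.SealSwap (PBot)

/-- class union (explicit lambda). -/
def unionClass (𝓚₁ 𝓚₂ : LevelClass) : LevelClass := fun η f x₀ s hmax R Hs B j =>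
  𝓚₁ η f x₀ s hmax R Hs B j ∨ 𝓚₂ η f x₀ s hmax R Hs B j

/-- sum of two allowances. -/
def addBudget (a₁ a₂ : Budget) : Budget := fun η f x₀ s hmax R Hs B => a₁ η f x₀ s hmax R Hs B + a₂ η f x₀ s hmax R Hs B

open Classical in
/-- (K) §B.5 the cost of a union splits as `𝓚₁` + (`𝓚₂ ∖ 𝓚₁`). -/
theorem netCostQ_union (𝓚₁ 𝓚₂ : LevelClass) (η : ℝ) (f : ℂ → ℂ) (x₀ s hmax R Hs : ℝ) (B k : ℕ) :
    netCostQ (unionClass 𝓚₁ 𝓚₂) η f x₀ s hmax R Hs B k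
      = netCostQ 𝓚₁ η f x₀ s hmax R Hs B k + netCostQ (diffClass 𝓚₂ 𝓚₁) η f x₀ s hmax R Hs B k := by
  simp only [netCostQ, unionClass, diffClass, ← Finset.sum_add_distrib]
  refine Finset.sum_congr rfl fun j _ => ?_
  by_cases hC : Charged (PTrkSQ PBot) StTrkDQ ReadyR2 η f x₀ s hmax R Hs B j <;>
    by_cases h1 : 𝓚₁ η f x₀ s hmax R Hs B j <;> by_cases h2 : 𝓚₂ η f x₀ s hmax R Hs B j <;> simp [hC, h1, h2]

/-- ★ (K) §B.5 **class laws ADD over a refinement**: a law for `𝓚₁` and a law for `𝓚₂ ∖ 𝓚₁` give a law for `𝓚₁ ∪ 𝓚₂` with the summed allowance —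
so any class of the (CA364) split may be refined further (e.g. C6's ENTRY events inside the consumption class) without a new socket. -/
theorem classLawQ_union {𝓚₁ 𝓚₂ : LevelClass} {a₁ a₂ : Budget}
    (h₁ : ClassLawQ 𝓚₁ a₁) (h₂ : ClassLawQ (diffClass 𝓚₂ 𝓚₁) a₂) : ClassLawQ (unionClass 𝓚₁ 𝓚₂) (addBudget a₁ a₂) := by
  intro η f x₀ s hmax R Hs B hE k hk
  rw [netCostQ_union, addBudget]
  exact add_le_add (h₁ η f x₀ s hmax R Hs B hE k hk) (h₂ η f x₀ s hmax R Hs B hE k hk)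

/-- (K) §B.5 a law is MONOTONE in the class extension: laws transfer along pointwise-equivalent classes. -/
theorem classLawQ_congr {𝓚₁ 𝓚₂ : LevelClass} {a : Budget}
    (heq : ∀ (η : ℝ) (f : ℂ → ℂ) (x₀ s hmax R Hs : ℝ) (B j : ℕ), 𝓚₁ η f x₀ s hmax R Hs B j ↔ 𝓚₂ η f x₀ s hmax R Hs B j)
    (h : ClassLawQ 𝓚₁ a) : ClassLawQ 𝓚₂ a := by
  have hfun : 𝓚₂ = 𝓚₁ := by
    funext η f x₀ s hmax R Hs B j
    exact propext (heq η f x₀ s hmax R Hs B j).symm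
  subst hfun
  exact h

open Classical in
/-- §B.5 the COUNT of the charged `𝓚`-levels below `k` (the director's literal (P4) is a count). -/
noncomputable def classCountQ (𝓚 : LevelClass) (η : ℝ) (f : ℂ → ℂ) (x₀ s hmax R Hs : ℝ) (B k : ℕ) : ℝ :=
  ∑ j ∈ Finset.range k,
    (if Charged (PTrkSQ PBot) StTrkDQ ReadyR2 η f x₀ s hmax R Hs B j ∧ 𝓚 η f x₀ s hmax R Hs B j then (1 : ℝ) else 0)

/-- §B.5 COUNT LAW SHAPE: the number of charged `𝓚`-levels stays within `a` (checked after every charged level). -/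
def CountLawQ (𝓚 : LevelClass) (a : Budget) : Prop :=
  ∀ (η : ℝ) (f : ℂ → ℂ) (x₀ s hmax R Hs : ℝ) (B : ℕ), EngineHyps5 2 η f x₀ s hmax R Hs B →
    ∀ k : ℕ, Charged (PTrkSQ PBot) StTrkDQ ReadyR2 η f x₀ s hmax R Hs B k →
      classCountQ 𝓚 η f x₀ s hmax R Hs B (k + 1) ≤ a η f x₀ s hmax R Hs B

/-- (T) §B.5 NO RISE ON THE CLASS: across a charged `𝓚`-level the lowest band height does not rise (`dropQ ≥ 0`). This is exactly where «lowH is not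
monotone across charged levels» (theft / landing outside the window) bites: a count law pays the books only together with it. -/
def NoRiseOnQ (𝓚 : LevelClass) : Prop :=
  ∀ (η : ℝ) (f : ℂ → ℂ) (x₀ s hmax R Hs : ℝ) (B : ℕ), EngineHyps5 2 η f x₀ s hmax R Hs B →
    ∀ j : ℕ, Charged (PTrkSQ PBot) StTrkDQ ReadyR2 η f x₀ s hmax R Hs B j → 𝓚 η f x₀ s hmax R Hs B j →
      lowH StTrkDQ η f x₀ s hmax R Hs B (j + 1) ≤ lowH StTrkDQ η f x₀ s hmax R Hs B j

open Classical in
/-- ★ (K) §B.5 **COUNT + NO-RISE ⟹ NET-COST LAW**: if the charged `𝓚`-levels never see a rise, their net cost is at most their number. -/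
theorem classLawQ_of_countLaw {𝓚 : LevelClass} {a : Budget} (hc : CountLawQ 𝓚 a) (hr : NoRiseOnQ 𝓚) : ClassLawQ 𝓚 a := by
  intro η f x₀ s hmax R Hs B hE k hk
  have hs : 0 < s := hE.2.2.2.1
  refine le_trans ?_ (hc η f x₀ s hmax R Hs B hE k hk)
  refine Finset.sum_le_sum fun j _ => ?_
  by_cases hj : Charged (PTrkSQ PBot) StTrkDQ ReadyR2 η f x₀ s hmax R Hs B j ∧ 𝓚 η f x₀ s hmax R Hs B j
  · rw [if_pos hj, if_pos hj]
    have hd : 0 ≤ dropQ η f x₀ s hmax R Hs B j := by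
      have := hr η f x₀ s hmax R Hs B hE j hj.1 hj.2
      unfold dropQ; linarith
    have : 0 ≤ 4 * dropQ η f x₀ s hmax R Hs B j / s := div_nonneg (by linarith) hs.le
    linarith
  · rw [if_neg hj, if_neg hj]

/-- (T, OPEN) §B.5 the director's literal (P4) as a COUNT: the approach levels NUMBER at most `aA`. -/
def ApproachCountLawQ (aA : Budget) : Prop := CountLawQ ApproachLevelQ aA

/-- ★ (K) §B.5 the COUNT version of (P4) plus «no rise across a charged approach level» gives the books-side (P4). -/
theorem approachAllowanceQ_of_count {aA : Budget} (hc : ApproachCountLawQ aA) (hr : NoRiseOnQ ApproachLevelQ) :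
    ApproachAllowanceQ aA :=
  classLawQ_of_countLaw hc hr

/-- (T) §B.5 NO RISE BEFORE THE HORIZON: on every pre-horizon level the lowest band height does not rise (needed by ENERGY potentials, which must
not rise on the levels they do not pay for). Possibly false on frames with pre-horizon theft — engines report rise events. -/
def NoRisePrehorizonQ : Prop :=
  ∀ (η : ℝ) (f : ℂ → ℂ) (x₀ s hmax R Hs : ℝ) (B : ℕ), EngineHyps5 2 η f x₀ s hmax R Hs B →
    ∀ k : ℕ, (∀ v : ℂ, ¬ ReadyR2 η f x₀ s hmax R Hs B k v) →
      lowH StTrkDQ η f x₀ s hmax R Hs B (k + 1) ≤ lowH StTrkDQ η f x₀ s hmax R Hs B k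

/-- §B.5 the JENSEN-ENERGY PURSE of the far class: `η²·lowH 0²/s²` (≤ `(hmax/s)²/4` on legal data, `energyPurseQ_le`). -/
noncomputable def energyPurseQ : Budget := fun η f x₀ s hmax R Hs B => η ^ 2 * lowH StTrkDQ η f x₀ s hmax R Hs B 0 ^ 2 / s ^ 2

/-- (K) §B.5 the energy purse is at most a quarter of `(hmax/s)²` on legal data (`2η ≤ 1`, `lowH 0 = rootHeight_Q ≤ rootHeight ≤ hmax`). -/
theorem energyPurseQ_le {η : ℝ} {f : ℂ → ℂ} {x₀ s hmax R Hs : ℝ} {B : ℕ} (hE : EngineHyps5 2 η f x₀ s hmax R Hs B) :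
    energyPurseQ η f x₀ s hmax R Hs B ≤ (hmax / s) ^ 2 / 4 := by
  have hη0 : 0 ≤ η := hE.2.2.2.2.2.2.2.2.2.2.2.2.2.1
  have hη1 : 2 * η ≤ 1 := hE.2.2.2.2.2.2.2.2.2.2.2.2.2.2.1
  have hl0 : 0 ≤ lowH StTrkDQ η f x₀ s hmax R Hs B 0 := RhW08.StSwap.lowH_nonneg _ _ _ _ _ _ _ _ _ _
  have hl1 : lowH StTrkDQ η f x₀ s hmax R Hs B 0 ≤ hmax := by
    rw [lowH_zero]; exact (rootHeight_stTrkDQ_le hE).trans (RhW08.Round2.rootHeight_stTrkD_le_hmax hE)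
  have hη2 : η ^ 2 ≤ 1 / 4 := by nlinarith
  have hl2 : lowH StTrkDQ η f x₀ s hmax R Hs B 0 ^ 2 ≤ hmax ^ 2 := pow_le_pow_left₀ hl0 hl1 2
  have hprod : η ^ 2 * lowH StTrkDQ η f x₀ s hmax R Hs B 0 ^ 2 ≤ 1 / 4 * hmax ^ 2 :=
    mul_le_mul hη2 hl2 (sq_nonneg _) (by norm_num)
  unfold energyPurseQ
  calc η ^ 2 * lowH StTrkDQ η f x₀ s hmax R Hs B 0 ^ 2 / s ^ 2 ≤ 1 / 4 * hmax ^ 2 / s ^ 2 :=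
        div_le_div_of_nonneg_right hprod (sq_nonneg s)
    _ = (hmax / s) ^ 2 / 4 := by ring

/-- ★★ (K) §B.5 **(R2) + NO-RISE ⟹ (P2)**: the per-level far-hover energy law and «no rise before the horizon» give the books-side far law with
allowance the energy purse `η²·lowH 0²/s²` — by the potential `Φ k := η²·lowH k²/s²` (`classLawQ_of_potential`): it pays `≥ 1 ≥ 1 − 4·dropQ/s`
across a charged far level and does not rise elsewhere. -/
theorem farLawQ_of_energyLaw (hR2 : FarEnergyLawQ) (hnr : NoRisePrehorizonQ) : FarLawQ energyPurseQ := by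
  refine classLawQ_of_potential (fun η f x₀ s hmax R Hs B k => η ^ 2 * lowH StTrkDQ η f x₀ s hmax R Hs B k ^ 2 / s ^ 2) ?_
  intro η f x₀ s hmax R Hs B hE
  have hs : 0 < s := hE.2.2.2.1
  have hs2 : 0 < s ^ 2 := by positivity
  refine ⟨fun k => by positivity, le_of_eq rfl, ?_⟩
  intro k hpre
  have hmono := hnr η f x₀ s hmax R Hs B hE k hpre
  have hl1 : 0 ≤ lowH StTrkDQ η f x₀ s hmax R Hs B (k + 1) := RhW08.StSwap.lowH_nonneg _ _ _ _ _ _ _ _ _ _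
  have hsq : lowH StTrkDQ η f x₀ s hmax R Hs B (k + 1) ^ 2 ≤ lowH StTrkDQ η f x₀ s hmax R Hs B k ^ 2 := pow_le_pow_left₀ hl1 hmono 2
  have hΦ : η ^ 2 * lowH StTrkDQ η f x₀ s hmax R Hs B (k + 1) ^ 2 / s ^ 2 ≤ η ^ 2 * lowH StTrkDQ η f x₀ s hmax R Hs B k ^ 2 / s ^ 2 :=
    div_le_div_of_nonneg_right (mul_le_mul_of_nonneg_left hsq (sq_nonneg η)) hs2.le
  by_cases hj : Charged (PTrkSQ PBot) StTrkDQ ReadyR2 η f x₀ s hmax R Hs B k ∧ FarLevelQ η f x₀ s hmax R Hs B k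
  · rw [if_pos hj]
    have hE2 := hR2 η f x₀ s hmax R Hs B hE k hj.1 hj.2
    have hd : 0 ≤ 4 * dropQ η f x₀ s hmax R Hs B k / s := div_nonneg (by unfold dropQ; linarith) hs.le
    -- `Φ k − Φ (k+1) = η²(E_k − E_{k+1})/s² ≥ 1`
    have hpay : 1 ≤ η ^ 2 * lowH StTrkDQ η f x₀ s hmax R Hs B k ^ 2 / s ^ 2
        - η ^ 2 * lowH StTrkDQ η f x₀ s hmax R Hs B (k + 1) ^ 2 / s ^ 2 := by
      rw [← sub_div, ← mul_sub, le_div_iff₀ hs2, one_mul]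
      exact hE2
    linarith
  · rw [if_neg hj, add_zero]
    exact hΦ

/-- ★★★ (K) §B.5 **THE POTENTIAL ROUTE TO (CA364)**: (R2) far energy law + no pre-horizon rise + (C) + the COUNT form of (P4) with no rise on approach
levels + capital `η²lowH 0²/s² + aC + aA ≤ S₀` ⟹ `RestRateBotQ`. Every hypothesis is a named, engine-measurable law. -/
theorem restRateBotQ_of_laws {aC aA : Budget} (hR2 : FarEnergyLawQ) (hnr : NoRisePrehorizonQ) (hC : ConsLawQ aC)
    (hA : ApproachCountLawQ aA) (hrA : NoRiseOnQ ApproachLevelQ) (hcap : CapitalLawQ energyPurseQ aC aA) : RestRateBotQ :=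
  restRateBotQ_of_CA364 (farLawQ_of_energyLaw hR2 hnr) hC (approachAllowanceQ_of_count hA hrA) hcap

/-! ## §B.6 potentials WITH A RISE ALLOWANCE (entries, thefts): rises are booked, not forbidden -/

open Classical in
/-- §B.6 prefix sum of a (rise) meter. -/
noncomputable def prefixSumQ (ρ : LevelMeter) (η : ℝ) (f : ℂ → ℂ) (x₀ s hmax R Hs : ℝ) (B k : ℕ) : ℝ :=
  ∑ j ∈ Finset.range k, ρ η f x₀ s hmax R Hs B j

open Classical in
/-- ★★ (K) §B.6 **POTENTIAL WITH A RISE ALLOWANCE**: as `classLawQ_of_potential`, but the potential may RISE by `ρ k ≥ 0` across level `k` (an ENTRY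
into the strip, a theft, …) provided the rises accumulated before the horizon stay within the allowance `aR`; conclusion `ClassLawQ 𝓚 (a + aR)`.
(C6 ADD-116: «ENTRY billed to the column budget like T₀ᴿ» = a rise allowance inside `B`.) -/
theorem classLawQ_of_potential_rises {𝓚 : LevelClass} {a aR : Budget} (Φ ρ : LevelMeter)
    (h0 : ∀ (η : ℝ) (f : ℂ → ℂ) (x₀ s hmax R Hs : ℝ) (B : ℕ), EngineHyps5 2 η f x₀ s hmax R Hs B →
      (∀ k : ℕ, 0 ≤ Φ η f x₀ s hmax R Hs B k) ∧ Φ η f x₀ s hmax R Hs B 0 ≤ a η f x₀ s hmax R Hs B ∧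
      (∀ k : ℕ, Charged (PTrkSQ PBot) StTrkDQ ReadyR2 η f x₀ s hmax R Hs B k →
        prefixSumQ ρ η f x₀ s hmax R Hs B (k + 1) ≤ aR η f x₀ s hmax R Hs B) ∧
      ∀ k : ℕ, (∀ v : ℂ, ¬ ReadyR2 η f x₀ s hmax R Hs B k v) →
        Φ η f x₀ s hmax R Hs B (k + 1)
          + (if Charged (PTrkSQ PBot) StTrkDQ ReadyR2 η f x₀ s hmax R Hs B k ∧ 𝓚 η f x₀ s hmax R Hs B k
              then 1 - 4 * dropQ η f x₀ s hmax R Hs B k / s else 0)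
          ≤ Φ η f x₀ s hmax R Hs B k + ρ η f x₀ s hmax R Hs B k) :
    ClassLawQ 𝓚 (addBudget a aR) := by
  intro η f x₀ s hmax R Hs B hE k hk
  obtain ⟨hpos, hinit, hrise, hstep⟩ := h0 η f x₀ s hmax R Hs B hE
  have hpre := prehorizon_of_chargedQ hk
  have key : ∀ m : ℕ, m ≤ k + 1 →
      netCostQ 𝓚 η f x₀ s hmax R Hs B m + Φ η f x₀ s hmax R Hs B m
        ≤ Φ η f x₀ s hmax R Hs B 0 + prefixSumQ ρ η f x₀ s hmax R Hs B m := by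
    intro m hm
    induction m with
    | zero => simp [netCostQ, prefixSumQ]
    | succ m ih =>
      have hm' : m ≤ k := by omega
      have := hstep m (hpre m hm')
      rw [netCostQ_succ, prefixSumQ, Finset.sum_range_succ, ← prefixSumQ]
      linarith [ih (by omega)]
  have h1 := key (k + 1) le_rfl
  have h2 := hrise k hk
  rw [addBudget]
  linarith [hpos (k + 1)]

/-- §B.6 the accumulated RISES of the Jensen energy potential `η²·lowH²/s²` below `k` (thefts / landings outside the window; `0` under `NoRisePrehorizonQ`). -/
noncomputable def energyRiseSumQ (η : ℝ) (f : ℂ → ℂ) (x₀ s hmax R Hs : ℝ) (B k : ℕ) : ℝ :=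
  prefixSumQ (fun η f x₀ s hmax R Hs B j =>
      max (η ^ 2 * lowH StTrkDQ η f x₀ s hmax R Hs B (j + 1) ^ 2 / s ^ 2 - η ^ 2 * lowH StTrkDQ η f x₀ s hmax R Hs B j ^ 2 / s ^ 2) 0)
    η f x₀ s hmax R Hs B k

/-- (T, OPEN) §B.6 ENERGY-RISE LAW: before the horizon the accumulated energy rises stay within the allowance `aR` (engines: report `energyRiseSumQ` at the
last charged level per legal frame; candidate: billed inside `B` like `T₀ᴿ`). -/
def EnergyRiseLawQ (aR : Budget) : Prop :=
  ∀ (η : ℝ) (f : ℂ → ℂ) (x₀ s hmax R Hs : ℝ) (B : ℕ), EngineHyps5 2 η f x₀ s hmax R Hs B →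
    ∀ k : ℕ, Charged (PTrkSQ PBot) StTrkDQ ReadyR2 η f x₀ s hmax R Hs B k →
      energyRiseSumQ η f x₀ s hmax R Hs B (k + 1) ≤ aR η f x₀ s hmax R Hs B

/-- ★★★ (K) §B.6 **(R2) + RISE ALLOWANCE ⟹ (P2)**, with NO monotonicity hypothesis: `FarEnergyLawQ → EnergyRiseLawQ aR → FarLawQ (energyPurseQ + aR)`.
Across a charged far level the energy law alone forces `lowH` DOWN (squares of non-negatives), so the level's own drop is a bonus; every other
pre-horizon move of the potential is booked as a rise. -/
theorem farLawQ_of_energyLaw_rises {aR : Budget} (hR2 : FarEnergyLawQ) (hr : EnergyRiseLawQ aR) :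
    FarLawQ (addBudget energyPurseQ aR) := by
  refine classLawQ_of_potential_rises
    (fun η f x₀ s hmax R Hs B k => η ^ 2 * lowH StTrkDQ η f x₀ s hmax R Hs B k ^ 2 / s ^ 2)
    (fun η f x₀ s hmax R Hs B j =>
      max (η ^ 2 * lowH StTrkDQ η f x₀ s hmax R Hs B (j + 1) ^ 2 / s ^ 2 - η ^ 2 * lowH StTrkDQ η f x₀ s hmax R Hs B j ^ 2 / s ^ 2) 0) ?_
  intro η f x₀ s hmax R Hs B hE
  have hs : 0 < s := hE.2.2.2.1
  have hs2 : 0 < s ^ 2 := by positivity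
  refine ⟨fun k => by positivity, le_of_eq rfl, fun k hk => hr η f x₀ s hmax R Hs B hE k hk, ?_⟩
  intro k _
  by_cases hj : Charged (PTrkSQ PBot) StTrkDQ ReadyR2 η f x₀ s hmax R Hs B k ∧ FarLevelQ η f x₀ s hmax R Hs B k
  · rw [if_pos hj]
    have hE2 := hR2 η f x₀ s hmax R Hs B hE k hj.1 hj.2
    have hl0 : 0 ≤ lowH StTrkDQ η f x₀ s hmax R Hs B k := RhW08.StSwap.lowH_nonneg _ _ _ _ _ _ _ _ _ _
    have hl1 : 0 ≤ lowH StTrkDQ η f x₀ s hmax R Hs B (k + 1) := RhW08.StSwap.lowH_nonneg _ _ _ _ _ _ _ _ _ _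
    -- the energy strictly drops, hence so does `lowH` (both non-negative): the level's own drop is non-negative
    have hEd : lowH StTrkDQ η f x₀ s hmax R Hs B (k + 1) ^ 2 < lowH StTrkDQ η f x₀ s hmax R Hs B k ^ 2 := by
      have hη : 0 ≤ η ^ 2 := sq_nonneg η
      by_contra hle
      rw [not_lt] at hle
      have : η ^ 2 * (lowH StTrkDQ η f x₀ s hmax R Hs B k ^ 2 - lowH StTrkDQ η f x₀ s hmax R Hs B (k + 1) ^ 2) ≤ 0 :=
        mul_nonpos_of_nonneg_of_nonpos hη (by linarith)
      linarith
    have hld : lowH StTrkDQ η f x₀ s hmax R Hs B (k + 1) < lowH StTrkDQ η f x₀ s hmax R Hs B k :=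
      lt_of_pow_lt_pow_left₀ 2 hl0 hEd
    have hd : 0 ≤ 4 * dropQ η f x₀ s hmax R Hs B k / s := div_nonneg (by unfold dropQ; linarith) hs.le
    have hpay : 1 ≤ η ^ 2 * lowH StTrkDQ η f x₀ s hmax R Hs B k ^ 2 / s ^ 2
        - η ^ 2 * lowH StTrkDQ η f x₀ s hmax R Hs B (k + 1) ^ 2 / s ^ 2 := by
      rw [← sub_div, ← mul_sub, le_div_iff₀ hs2, one_mul]
      exact hE2
    have hρ := le_max_right (η ^ 2 * lowH StTrkDQ η f x₀ s hmax R Hs B (k + 1) ^ 2 / s ^ 2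
      - η ^ 2 * lowH StTrkDQ η f x₀ s hmax R Hs B k ^ 2 / s ^ 2) 0
    linarith
  · rw [if_neg hj, add_zero]
    linarith [le_max_left (η ^ 2 * lowH StTrkDQ η f x₀ s hmax R Hs B (k + 1) ^ 2 / s ^ 2
      - η ^ 2 * lowH StTrkDQ η f x₀ s hmax R Hs B k ^ 2 / s ^ 2) 0]

/-- ★★★ (K) §B.6 **(CA364) with rises booked**: (R2) + energy-rise allowance + (C) + (P4, net form) + capital `(energyPurseQ + aR) + aC + aA ≤ S₀` ⟹ `RestRateBotQ`. -/
theorem restRateBotQ_of_laws_rises {aR aC aA : Budget} (hR2 : FarEnergyLawQ) (hr : EnergyRiseLawQ aR) (hC : ConsLawQ aC)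
    (hA : ApproachAllowanceQ aA) (hcap : CapitalLawQ (addBudget energyPurseQ aR) aC aA) : RestRateBotQ :=
  restRateBotQ_of_CA364 (farLawQ_of_energyLaw_rises hR2 hr) hC hA hcap

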